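import Summits.CriticalPhenomena.SAWScalingLimit.Theses.SAWRenewalTightness
import Literature.Probability.RandomPlanarGeometry.TriangleDomain
import Literature.Probability.RandomPlanarGeometry.ChordalCurveFamily

/-!
# `ShellCrossingBound` — negative knowledge: forcing corridors (the uniform-threshold Aizenman–Burchard hypothesis is false for the critical SAW)

Part 1: the damped topologist's-sine centre line `ctr`, the shear homeomorphism, the base triangle and the witness Dobrushin domain `forcingDomain`, and the identification of its carrier with the sheared open wedge (`carrier_eq_SW`).

Support file for crux `stmt-CriticalPhenomena-4728` (refuter `cdisprove`; work file
`Summits/CriticalPhenomena/SAWScalingLimit/Cruxes/ShellCrossingBound/Disproof.lean`; conclusion in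
`Negative/UniformThresholdFalse.lean`). Everything proved. [folklore]
-/

noncomputable section

open Set Filter Topology Metric MeasureTheory Complex
open scoped ENNReal Real
open Literature.Probability.RandomPlanarGeometry Literature.Probability.LatticeModels

namespace Summit.CriticalPhenomena.SAWScalingLimit.Theorems.ShellCrossingBound.Negative.Forcing

/-! ## A.1 The centre line -/

/-- The damped topologist's sine `ctr x = √x · sin (π / x)` (`= 0` for `x ≤ 0`, since `√x = 0`,
and at `x = 0` by Lean's `π / 0 = 0`). [folklore] -/
def ctr (x : ℝ) : ℝ := Real.sqrt x * Real.sin (π / x)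

/-- The centre line vanishes at `0`. [folklore] -/
theorem ctr_zero : ctr 0 = 0 := by simp [ctr]

/-- The centre line vanishes at `1` (`sin π = 0`). [folklore] -/
theorem ctr_one : ctr 1 = 0 := by simp [ctr]

/-- `|ctr x| ≤ √x` (`|sin| ≤ 1`). [folklore] -/
theorem abs_ctr_le (x : ℝ) : |ctr x| ≤ Real.sqrt x := by
  rw [ctr, abs_mul, abs_of_nonneg (Real.sqrt_nonneg x)]
  exact mul_le_of_le_one_right (Real.sqrt_nonneg x) (Real.abs_sin_le_one _)

/-- `|ctr x| ≤ √|x|`. [folklore] -/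
theorem abs_ctr_le_sqrt_abs (x : ℝ) : |ctr x| ≤ Real.sqrt |x| :=
  (abs_ctr_le x).trans (Real.sqrt_le_sqrt (le_abs_self x))

/-- `ctr` is continuous (away from `0` a composite of continuous maps; at `0` squeezed by `√|x|`).
[folklore] -/
theorem continuous_ctr : Continuous ctr := by
  rw [continuous_iff_continuousAt]
  intro x
  by_cases hx : x = 0
  · subst hx
    rw [ContinuousAt, ctr_zero]
    have hg : Tendsto (fun x : ℝ => Real.sqrt |x|) (𝓝 0) (𝓝 0) := by
      have : Continuous fun x : ℝ => Real.sqrt |x| := Real.continuous_sqrt.comp continuous_abs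
      simpa using this.tendsto 0
    exact squeeze_zero_norm (fun x => by simpa [Real.norm_eq_abs] using abs_ctr_le_sqrt_abs x) hg
  · have h1 : ContinuousAt (fun x : ℝ => Real.sin (π / x)) x :=
      (Real.continuous_sin.continuousAt).comp (continuousAt_const.div continuousAt_id hx)
    exact Real.continuous_sqrt.continuousAt.mul h1

/-! ## A.2 The shear homeomorphism -/

/-- The vertical shear `z ↦ z + ctr (re z) · i` of the plane. [folklore] -/
def shear : ℂ ≃ₜ ℂ where
  toFun z := z + (ctr z.re : ℂ) * Complex.I
  invFun z := z - (ctr z.re : ℂ) * Complex.I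
  left_inv z := by simp
  right_inv z := by simp
  continuous_toFun := by
    have : Continuous fun z : ℂ => (ctr z.re : ℂ) * Complex.I :=
      (continuous_ofReal.comp (continuous_ctr.comp continuous_re)).mul continuous_const
    exact continuous_id.add this
  continuous_invFun := by
    have : Continuous fun z : ℂ => (ctr z.re : ℂ) * Complex.I :=
      (continuous_ofReal.comp (continuous_ctr.comp continuous_re)).mul continuous_const
    exact continuous_id.sub this

/-- Pointwise formula for the shear. [folklore] -/
@[simp] theorem shear_apply (z : ℂ) : shear z = z + (ctr z.re : ℂ) * Complex.I := rfl

/-- Pointwise formula for the inverse shear. [folklore] -/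
@[simp] theorem shear_symm_apply (z : ℂ) : shear.symm z = z - (ctr z.re : ℂ) * Complex.I := rfl

/-- The shear preserves abscissae. [folklore] -/
@[simp] theorem shear_re (z : ℂ) : (shear z).re = z.re := by simp

/-- The shear translates ordinates by the centre line. [folklore] -/
@[simp] theorem shear_im (z : ℂ) : (shear z).im = z.im + ctr z.re := by simp

/-- The inverse shear preserves abscissae. [folklore] -/
theorem shear_symm_re (z : ℂ) : (shear.symm z).re = z.re := by simp

/-- The inverse shear translates ordinates back. [folklore] -/
theorem shear_symm_im (z : ℂ) : (shear.symm z).im = z.im - ctr z.re := by simp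

/-- The shear fixes the pinch point `0`. [folklore] -/
theorem shear_zero : shear 0 = 0 := by simp [ctr_zero]

/-! ## A.3 The base triangle and the witness domain -/

/-- Wedge slope. [folklore] -/
def sl : ℝ := 1 / 4

/-- The wedge slope is positive. [folklore] -/
theorem sl_pos : 0 < sl := by norm_num [sl]

/-- The wedge slope is less than one. [folklore] -/
theorem sl_lt_one : sl < 1 := by norm_num [sl]

/-- Lower right vertex `1 - i/4`. [folklore] -/
def vB : ℂ := ⟨1, -sl⟩

/-- Upper right vertex `1 + i/4`. [folklore] -/
def vC : ℂ := ⟨1, sl⟩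

/-- The base triangle is non-degenerate. [folklore] -/
theorem affineIndependent_triangle : AffineIndependent ℝ ![(0 : ℂ), vB, vC] := by
  rw [affineIndependent_iff_not_collinear_set]
  intro hcol
  rw [collinear_iff_of_mem (p₀ := (0 : ℂ)) (by simp)] at hcol
  obtain ⟨v, hv⟩ := hcol
  obtain ⟨r₁, hr₁⟩ := hv vB (by simp)
  obtain ⟨r₂, hr₂⟩ := hv vC (by simp)
  simp only [vadd_eq_add, add_zero] at hr₁ hr₂
  have h1 := congrArg Complex.re hr₁
  have h2 := congrArg Complex.im hr₁
  have h3 := congrArg Complex.re hr₂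
  have h4 := congrArg Complex.im hr₂
  simp only [vB, vC, smul_re, smul_im, smul_eq_mul] at h1 h2 h3 h4
  -- 1 = r₁ v.re, -sl = r₁ v.im, 1 = r₂ v.re, sl = r₂ v.im
  have hs := sl_pos
  have : r₁ * v.im * (r₂ * v.re) = r₂ * v.im * (r₁ * v.re) := by ring
  rw [← h1, ← h2, ← h3, ← h4] at this
  linarith

/-- The base triangle `(Δ; 0, 1 - i/4)` as a Dobrushin domain (Carleson's rectangle with the
first two marks kept). [folklore] -/
def baseDomain : DobrushinDomain :=
  (triangleRectangle 0 vB vC affineIndependent_triangle (1 / 2) ⟨by norm_num, by norm_num⟩).chord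
    0 1 (by decide)

/-- Carrier of the base triangle: the open solid triangle. [folklore] -/
theorem baseDomain_carrier : baseDomain.carrier = interior (convexHull ℝ {(0 : ℂ), vB, vC}) := rfl

/-- First marked point of the base triangle: the future pinch point `0`. [folklore] -/
theorem baseDomain_pt_zero : baseDomain.pt 0 = 0 := by
  rw [baseDomain, MarkedDomain.pt_chord_zero]
  exact (triangleRectangle_pt affineIndependent_triangle _).1

/-- Second marked point of the base triangle: the corner `1 - i/4`. [folklore] -/
theorem baseDomain_pt_one : baseDomain.pt 1 = vB := by
  rw [baseDomain, MarkedDomain.pt_chord_one]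
  exact (triangleRectangle_pt affineIndependent_triangle _).2.1

/-- **The witness domain**: the sheared triangle, pinching at the marked point `a = 0` along the
damped topologist's sine. [folklore] -/
def forcingDomain : DobrushinDomain := baseDomain.map shear

/-- Carrier of the witness domain: the sheared open triangle. [folklore] -/
theorem forcingDomain_carrier :
    forcingDomain.carrier = shear '' interior (convexHull ℝ {(0 : ℂ), vB, vC}) := rfl

/-- First marked point of the witness domain: the pinch point `a = 0`. [folklore] -/
theorem forcingDomain_pt_zero : forcingDomain.pt 0 = 0 := by
  rw [forcingDomain, MarkedDomain.pt_map, baseDomain_pt_zero, shear_zero]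

/-- Second marked point of the witness domain: `b = 1 - i/4` (the shear fixes the line `re = 1`). [folklore] -/
theorem forcingDomain_pt_one : forcingDomain.pt 1 = vB := by
  rw [forcingDomain, MarkedDomain.pt_map, baseDomain_pt_one]
  apply Complex.ext <;> simp [vB, ctr_one]

/-! ## A.4 The wedge sandwich -/

/-- Open wedge-triangle. [folklore] -/
def W : Set ℂ := {z | |z.im| < sl * z.re ∧ z.re < 1}

/-- Closed wedge-triangle. [folklore] -/
def Wc : Set ℂ := {z | |z.im| ≤ sl * z.re ∧ z.re ≤ 1}

/-- The closed wedge-triangle is convex. [folklore] -/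
theorem convex_Wc : Convex ℝ Wc := by
  intro z hz w hw p q hp hq hpq
  obtain ⟨hz1, hz2⟩ := hz
  obtain ⟨hw1, hw2⟩ := hw
  refine ⟨?_, ?_⟩
  · simp only [add_im, smul_im, smul_eq_mul, add_re, smul_re]
    calc |p * z.im + q * w.im| ≤ |p * z.im| + |q * w.im| := abs_add_le _ _
      _ = p * |z.im| + q * |w.im| := by rw [abs_mul, abs_mul, abs_of_nonneg hp, abs_of_nonneg hq]
      _ ≤ p * (sl * z.re) + q * (sl * w.re) := by gcongr
      _ = sl * (p * z.re + q * w.re) := by ring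
  · simp only [add_re, smul_re, smul_eq_mul]
    nlinarith

/-- The solid triangle lies in the closed wedge-triangle. [folklore] -/
theorem convexHull_subset_Wc : convexHull ℝ {(0 : ℂ), vB, vC} ⊆ Wc := by
  refine convexHull_min ?_ convex_Wc
  intro z hz
  simp only [mem_insert_iff, mem_singleton_iff] at hz
  rcases hz with rfl | rfl | rfl
  · simp [Wc]
  · refine ⟨?_, ?_⟩ <;> simp [vB, abs_of_pos sl_pos]
  · refine ⟨?_, ?_⟩ <;> simp [vC, abs_of_pos sl_pos]

/-- The closed wedge-triangle is closed. [folklore] -/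
theorem isClosed_Wc : IsClosed Wc := by
  have h1 : IsClosed {z : ℂ | |z.im| ≤ sl * z.re} :=
    isClosed_le (continuous_abs.comp continuous_im) (continuous_const.mul continuous_re)
  have h2 : IsClosed {z : ℂ | z.re ≤ 1} := isClosed_le continuous_re continuous_const
  exact h1.inter h2

/-- The open wedge-triangle is open. [folklore] -/
theorem isOpen_W : IsOpen W := by
  have h1 : IsOpen {z : ℂ | |z.im| < sl * z.re} :=
    isOpen_lt (continuous_abs.comp continuous_im) (continuous_const.mul continuous_re)
  have h2 : IsOpen {z : ℂ | z.re < 1} := isOpen_lt continuous_re continuous_const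
  exact h1.inter h2

/-- Real scalar multiplication of a complex number in coordinates. [folklore] -/
theorem smul_mk (θ a b : ℝ) : θ • (⟨a, b⟩ : ℂ) = ⟨θ * a, θ * b⟩ := by
  apply Complex.ext <;> simp

/-- The open wedge-triangle lies in the solid triangle (explicit convex combinations). [folklore] -/
theorem W_subset_convexHull : W ⊆ convexHull ℝ {(0 : ℂ), vB, vC} := by
  intro z hz
  obtain ⟨hz1, hz2⟩ := hz
  have hre : 0 < z.re := by
    have := abs_nonneg z.im
    nlinarith [sl_pos]
  rw [convexHull_insert (by simp), convexJoin_singleton_left]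
  simp only [mem_iUnion, exists_prop]
  -- the point of the right side above `z / re z`
  refine ⟨⟨1, z.im / z.re⟩, ?_, ?_⟩
  · rw [convexHull_pair, segment_eq_image']
    refine ⟨(z.im / z.re + sl) / (2 * sl), ⟨?_, ?_⟩, ?_⟩
    · apply div_nonneg _ (by linarith [sl_pos])
      have : -sl < z.im / z.re := by
        rw [lt_div_iff₀ hre]; linarith [neg_abs_le z.im]
      linarith
    · rw [div_le_one (by linarith [sl_pos])]
      have : z.im / z.re < sl := by
        rw [div_lt_iff₀ hre]; linarith [le_abs_self z.im]
      linarith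
    · have hsub : vC - vB = (⟨0, 2 * sl⟩ : ℂ) := by
        apply Complex.ext
        · simp [vB, vC]
        · simp [vB, vC]; ring
      rw [hsub]
      beta_reduce
      rw [smul_mk]
      apply Complex.ext
      · simp [vB]
      · simp only [vB, add_im]
        have hs : sl ≠ 0 := sl_pos.ne'
        field_simp
        ring
  · rw [segment_eq_image']
    refine ⟨z.re, ⟨hre.le, hz2.le⟩, ?_⟩
    beta_reduce
    rw [sub_zero, zero_add, smul_mk]
    apply Complex.ext
    · simp
    · simp only
      field_simp

/-- The open wedge-triangle lies in the open solid triangle. [folklore] -/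
theorem W_subset_interior : W ⊆ interior (convexHull ℝ {(0 : ℂ), vB, vC}) :=
  interior_maximal W_subset_convexHull isOpen_W

/-- Sheared open wedge. [folklore] -/
def SW : Set ℂ := {z | |z.im - ctr z.re| < sl * z.re ∧ z.re < 1}

/-- Sheared closed wedge. [folklore] -/
def SWc : Set ℂ := {z | |z.im - ctr z.re| ≤ sl * z.re ∧ z.re ≤ 1}

/-- Membership in the witness carrier, pulled back through the shear. [folklore] -/
theorem mem_carrier_iff (z : ℂ) :
    z ∈ forcingDomain.carrier ↔ shear.symm z ∈ interior (convexHull ℝ {(0 : ℂ), vB, vC}) := by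
  rw [forcingDomain_carrier, ← shear.preimage_symm, mem_preimage]

/-- The sheared open wedge lies in the witness carrier. [folklore] -/
theorem SW_subset_carrier : SW ⊆ forcingDomain.carrier := by
  intro z hz
  rw [mem_carrier_iff]
  apply W_subset_interior
  refine ⟨?_, ?_⟩
  · rw [shear_symm_im, shear_symm_re]; exact hz.1
  · rw [shear_symm_re]; exact hz.2

/-- The witness carrier lies in the sheared closed wedge. [folklore] -/
theorem carrier_subset_SWc : forcingDomain.carrier ⊆ SWc := by
  intro z hz
  rw [mem_carrier_iff] at hz
  have h := convexHull_subset_Wc (interior_subset hz)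
  obtain ⟨h1, h2⟩ := h
  rw [shear_symm_im, shear_symm_re] at h1
  rw [shear_symm_re] at h2
  exact ⟨h1, h2⟩

/-- The sheared closed wedge is closed. [folklore] -/
theorem isClosed_SWc : IsClosed SWc := by
  have h1 : IsClosed {z : ℂ | |z.im - ctr z.re| ≤ sl * z.re} :=
    isClosed_le (continuous_abs.comp (continuous_im.sub (continuous_ctr.comp continuous_re)))
      (continuous_const.mul continuous_re)
  have h2 : IsClosed {z : ℂ | z.re ≤ 1} := isClosed_le continuous_re continuous_const
  exact h1.inter h2

/-- The closure of the witness carrier lies in the sheared closed wedge. [folklore] -/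
theorem closure_carrier_subset_SWc : closure forcingDomain.carrier ⊆ SWc :=
  closure_minimal carrier_subset_SWc isClosed_SWc


/-! ## A.5 The carrier is exactly the sheared open wedge -/

/-- The witness carrier lies in the sheared OPEN wedge (openness makes the wedge inequalities strict). [folklore] -/
theorem carrier_subset_SW : forcingDomain.carrier ⊆ SW := by
  intro z hz
  have hopen := forcingDomain.isOpen
  obtain ⟨ε, hε, hball⟩ := Metric.isOpen_iff.1 hopen z hz
  have hmem : ∀ w, dist w z < ε → w ∈ SWc := fun w hw => carrier_subset_SWc (hball hw)
  obtain ⟨h1, h2⟩ := carrier_subset_SWc hz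
  refine ⟨?_, ?_⟩
  · -- strictness of the wedge inequality: perturb vertically
    rcases h1.lt_or_eq with hlt | heq
    · exact hlt
    · exfalso
      rcases le_or_gt 0 (z.im - ctr z.re) with hnn | hneg
      · -- move up
        have hw := hmem (z + ((ε / 2 : ℝ) : ℂ) * Complex.I) (by
          rw [dist_eq_norm]; simp [abs_of_pos hε]; linarith)
        obtain ⟨hw1, -⟩ := hw
        simp only [add_im, mul_im, ofReal_re, I_im, mul_one, ofReal_im, I_re, mul_zero, add_zero,
          add_re, mul_re, sub_self] at hw1
        rw [abs_of_nonneg hnn] at heq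
        have : |z.im + ε / 2 - ctr z.re| = z.im - ctr z.re + ε / 2 := by
          rw [abs_of_nonneg (by linarith)]; ring
        rw [this, heq] at hw1
        linarith
      · -- move down
        have hw := hmem (z - ((ε / 2 : ℝ) : ℂ) * Complex.I) (by
          rw [dist_eq_norm]; simp [abs_of_pos hε]; linarith)
        obtain ⟨hw1, -⟩ := hw
        simp only [sub_im, mul_im, ofReal_re, I_im, mul_one, ofReal_im, I_re, mul_zero, add_zero,
          sub_re, mul_re, sub_self, sub_zero] at hw1
        rw [abs_of_neg hneg] at heq
        have : |z.im - ε / 2 - ctr z.re| = -(z.im - ctr z.re) + ε / 2 := by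
          rw [abs_of_neg (by linarith)]; ring
        rw [this, heq] at hw1
        linarith
  · rcases h2.lt_or_eq with hlt | heq
    · exact hlt
    · exfalso
      have hw := hmem (z + ((ε / 2 : ℝ) : ℂ)) (by
        rw [dist_eq_norm]; simp [abs_of_pos hε, hε])
      obtain ⟨-, hw2⟩ := hw
      simp only [add_re, ofReal_re] at hw2
      linarith

/-- **The witness carrier is exactly the sheared open wedge.** [folklore] -/
theorem carrier_eq_SW : forcingDomain.carrier = SW :=
  Subset.antisymm carrier_subset_SW SW_subset_carrier

end Summit.CriticalPhenomena.SAWScalingLimit.Theorems.ShellCrossingBound.Negative.Forcing
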